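import Literature.Algebra.Homology.OrderedCechPairSystemColumnCollapse
import Literature.AlgebraicGeometry.Modules.CechProductCoverLexSystem
import Literature.AlgebraicGeometry.Modules.ModuleCechRefinementTransport
import HarnessLib

/-!
# Column collapse on a product cover: Čech cohomology of `G` on `(p⁻¹U_i ∩ q⁻¹V_j)_{(i,j)}` from the slices
# `Č•((p⁻¹U_σ ∩ q⁻¹V_j)_j, G)` (Stacks 0BEC, 0133; Mumford, *Abelian Varieties*, §8 proof of Thm. 1)

Layer `Literature/AlgebraicGeometry/Modules`, namespace `Literature.AlgebraicGeometry.Modules`.  THEOREMS ONLY (no definition, no named fact, no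
instance, no notation, no `sorry`).  The geometric reading of ★ `Algebra/Homology/OrderedCechPairSystemColumnCollapse` on the pair-system of
sections `boxSectionsSystem p q 𝓤 𝓥 G ρ` (★ `Modules/CechBoxTensorBicomplex`: `(σ, t) ↦ Γ(G, p⁻¹U_σ ∩ q⁻¹V_t)`, ANY `𝒪_Z`-module `G`, any
`p : Z → X`, `q : Z → Y`, families of opens `𝓤` of `X`, `𝓥` of `Y`) and the product cover `W₀ (i, j) := p⁻¹U_i ∩ q⁻¹V_j` (★
`Modules/CechProductCoverLexSystem`: `Č(lexSystem (boxSectionsSystem …)) ≅ Č(W₀, G)`):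

* §1 `cechOpen_inf_left`, **`nonempty_sysComplex_boxSectionsSystem_obj_iso`** — for `σ ⊆ ι` the member system `t ↦ Γ(G, p⁻¹U_σ ∩ q⁻¹V_t)`
  has ordered Čech complex ISOMORPHIC to the module Čech complex of `G` for the SLICE COVER `(p⁻¹U_σ ∩ q⁻¹V_j)_j` of the open `p⁻¹U_σ` (the two
  systems agree on non-empty `t`, ★ `OrderedCech.sysComplexIsoNE`); `exactAt_sysComplex_boxSectionsSystem_obj_iff`.
* §2 **`exactAt_cechComplex_prodCover_of_forall_slice`** — «FIBREWISE ACYCLIC ⇒ ACYCLIC»: if every slice complex (`σ ≠ ∅`) is exact in every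
  degree, `Č(W₀, G)` is exact in every degree; **`exactAt_cechComplex_slice_of_exactAt_prodCover`** — «SUPPORT»: if the slice complexes with
  `#σ ≥ 2` are exact in every degree and `Č(W₀, G)` is exact in degree `n`, then the slice complex of every single `U_i` is exact in degree `n`.
* §4 (ED. 2) **`exactAt_cechComplex_iff_of_scalars`** — exactness of `Č(𝓥, L; ρ)` does not depend on the scalar map `ρ` (same additive
  complex); `subsingleton_homology_cechComplex_iff_of_scalars`.
* §3 **`exactAt_cechComplex_prodCover_swap_iff`** — the product cover with the roles of `p, 𝓤` and `q, 𝓥` exchanged (index `κ ×ₗ ι`) has the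
  same exactness in every degree (the two covers refine each other; ★ `Modules/ModuleCechRefinementTransport`), so a consumer may collapse
  along EITHER factor ([MumfordAV1970] §8 proof of Thm. 1: first along `p₁`, then along `p₂`).

Consumer: cell `hodgecm-mathlib` (D-0151), DUAL-S road (A), «CBC cut» head (CBC-2) (B-p08 (g33)); with (CBC-1) «fibrewise-exact ⇒ exact» on the
Grothendieck complex of each `A × U_σ → U_σ` and (CBC-3) the kernel family this gives [MumfordAV1970] §8 Thm. 1 in any characteristic (CBC-4).
Library only (count-neutral); proves nothing about any crux, route or conjecture; HC_CM is proved only modulo the printed citations until rung 0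
closes.  Mathlib searched (pin): `Finset.inf_le`, `Finset.le_inf`, `inf_le_inf_left`, `LinearEquiv.ofLinear`, `exactAt_iff_of_quasiIsoAt`,
`HomologicalComplex.exactAt_iff_isZero_homology`, `ModuleCat.isZero_of_subsingleton`, `ModuleCat.subsingleton_of_isZero` (used).

## References

* The Stacks Project, Tag 0BEC (the double Čech complex of two coverings), Tag 0133, Tag 01XD. [StacksProject]
* D. Mumford, *Abelian Varieties* (1970), §8 proof of Theorem 1 (p. 77). [MumfordAV1970]
* U. Görtz, T. Wedhorn, *Algebraic Geometry II* (2023), Def. 21.64, Def. 21.68 (pp. 179–180), Thm. 22.9 (p. 236). [GortzWedhorn2023]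
-/

set_option backward.isDefEq.respectTransparency false -- `Scheme.Modules` is not reducible (as in ★ `CechBoxTensorBicomplex`)

noncomputable section

universe u

open CategoryTheory CategoryTheory.Limits AlgebraicGeometry TopologicalSpace HomologicalComplex
open Literature.Algebra.Homology Literature.Algebra.Homology.OrderedCech

namespace Literature.AlgebraicGeometry.Modules

section Slices

variable {X Y Z : Scheme.{u}} (p : Z ⟶ X) (q : Z ⟶ Y) {A : Type u} [CommRing A]
  {ι κ : Type} [LinearOrder ι] [LinearOrder κ] (𝓤 : ι → X.Opens) (𝓥 : κ → Y.Opens) (G : Z.Modules) (ρ : A →+* Γ(Z, ⊤))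

/-! ## §1 The member systems of `boxSectionsSystem` are slice Čech complexes -/

omit [LinearOrder κ] in
/-- `⋂_{j ∈ t} (W ∩ W_j) = W ∩ ⋂_{j ∈ t} W_j` for NON-EMPTY `t` (for `t = ∅` the left side is `⊤`). [cite: GortzWedhorn2023, Def. 21.64 (p. 179)] -/
theorem cechOpen_inf_left (W : Z.Opens) (𝓦 : κ → Z.Opens) (t : Finset κ) (ht : t.Nonempty) :
    cechOpen (fun j => W ⊓ 𝓦 j) t = W ⊓ cechOpen 𝓦 t := by
  apply le_antisymm
  · obtain ⟨j₀, hj₀⟩ := ht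
    exact le_inf ((cechOpen_le _ hj₀).trans inf_le_left) (Finset.le_inf fun j hj => (cechOpen_le _ hj).trans inf_le_right)
  · exact Finset.le_inf fun j hj => inf_le_inf_left W (cechOpen_le 𝓦 hj)

omit [LinearOrder ι] [LinearOrder κ] in
/-- The slice opens: `⋂_{j ∈ t} (p⁻¹U_σ ∩ q⁻¹V_j) = p⁻¹U_σ ∩ q⁻¹V_t` for non-empty `t`. [cite: StacksProject, Tag 0BEC] -/
theorem cechOpen_slice_eq (σ : Finset ι) (t : Finset κ) (ht : t.Nonempty) :
    cechOpen (fun j => p ⁻¹ᵁ cechOpen 𝓤 σ ⊓ q ⁻¹ᵁ 𝓥 j) t = p ⁻¹ᵁ cechOpen 𝓤 σ ⊓ q ⁻¹ᵁ cechOpen 𝓥 t := by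
  rw [cechOpen_inf_left _ _ _ ht, ← preimage_cechOpen]

omit [LinearOrder ι] in
/-- **`Č•(t ↦ Γ(G, p⁻¹U_σ ∩ q⁻¹V_t)) ≅ Č((p⁻¹U_σ ∩ q⁻¹V_j)_j, G)`**: the member of `boxSectionsSystem p q 𝓤 𝓥 G ρ` at `σ` has ordered Čech complex
isomorphic to the module Čech complex of the slice cover — the two `κ`-systems agree (by restriction along `cechOpen_slice_eq`) on every non-empty
`t`, which is all the ordered Čech complex reads (★ `OrderedCech.sysComplexIsoNE`). [cite: StacksProject, Tag 0BEC] [cite: GortzWedhorn2023, Def. 21.68 (p. 180)] -/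
theorem nonempty_sysComplex_boxSectionsSystem_obj_iso (σ : Finset ι) :
    Nonempty (sysComplex ((boxSectionsSystem p q 𝓤 𝓥 G ρ).obj σ) ≅
      cechComplex (fun j => p ⁻¹ᵁ cechOpen 𝓤 σ ⊓ q ⁻¹ᵁ 𝓥 j) G ρ) := by
  let e : ∀ t : Finset κ, t.Nonempty →
      (SecMod G ρ (p ⁻¹ᵁ cechOpen 𝓤 σ ⊓ q ⁻¹ᵁ cechOpen 𝓥 t) ≃ₗ[A]
        SecMod G ρ (cechOpen (fun j => p ⁻¹ᵁ cechOpen 𝓤 σ ⊓ q ⁻¹ᵁ 𝓥 j) t)) := fun t ht =>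
    LinearEquiv.ofLinear
      (SecMod.res G ρ (le_of_eq (cechOpen_slice_eq p q 𝓤 𝓥 σ t ht)))
      (SecMod.res G ρ (le_of_eq (cechOpen_slice_eq p q 𝓤 𝓥 σ t ht).symm))
      (LinearMap.ext fun x => by
        change SecMod.res G ρ _ (SecMod.res G ρ _ x) = x
        rw [SecMod.res_res]; exact SecMod.res_self _ x)
      (LinearMap.ext fun x => by
        change SecMod.res G ρ _ (SecMod.res G ρ _ x) = x
        rw [SecMod.res_res]; exact SecMod.res_self _ x)
  refine ⟨sysComplexIsoNE e fun s t hs ht h x => ?_⟩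
  change SecMod.res G ρ _ (SecMod.res G ρ _ x) = SecMod.res G ρ _ (SecMod.res G ρ _ x)
  rw [SecMod.res_res, SecMod.res_res]

omit [LinearOrder ι] in
/-- Exactness of the member system at `σ` is exactness of the slice Čech complex (`nonempty_sysComplex_boxSectionsSystem_obj_iso`).
[cite: StacksProject, Tag 0BEC] -/
theorem exactAt_sysComplex_boxSectionsSystem_obj_iff (σ : Finset ι) (b : ℤ) :
    (sysComplex ((boxSectionsSystem p q 𝓤 𝓥 G ρ).obj σ)).ExactAt b ↔
      (cechComplex (fun j => p ⁻¹ᵁ cechOpen 𝓤 σ ⊓ q ⁻¹ᵁ 𝓥 j) G ρ).ExactAt b := by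
  obtain ⟨e⟩ := nonempty_sysComplex_boxSectionsSystem_obj_iso p q 𝓤 𝓥 G ρ σ
  exact exactAt_iff_of_quasiIsoAt e.hom b

/-! ## §2 Collapse along `p`: the product cover from its slices -/

/-- Exactness transfers along ★ `exists_sysComplex_lexSystem_iso_cechComplex`. [cite: StacksProject, Tag 0BEC] -/
theorem exactAt_cechComplex_prodCover_iff_lexSystem (n : ℤ) :
    (cechComplex (fun c : ι ×ₗ κ => p ⁻¹ᵁ 𝓤 (ofLex c).1 ⊓ q ⁻¹ᵁ 𝓥 (ofLex c).2) G ρ).ExactAt n ↔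
      (sysComplex (lexSystem (boxSectionsSystem p q 𝓤 𝓥 G ρ))).ExactAt n := by
  obtain ⟨e, -⟩ := exists_sysComplex_lexSystem_iso_cechComplex p q 𝓤 𝓥 G ρ
  exact (exactAt_iff_of_quasiIsoAt e.hom n).symm

/-- **FIBREWISE ACYCLIC ⇒ ACYCLIC on a product cover**: if for every non-empty `σ ⊆ ι` the slice Čech complex `Č((p⁻¹U_σ ∩ q⁻¹V_j)_j, G)` is exact in
every degree, then the Čech complex of `G` on the product cover `(p⁻¹U_i ∩ q⁻¹V_j)_{(i,j) ∈ ι ×ₗ κ}` is exact in every degree.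
[cite: StacksProject, Tag 0133] [cite: MumfordAV1970, §8 proof of Theorem 1 (p. 77)] -/
theorem exactAt_cechComplex_prodCover_of_forall_slice
    (hcol : ∀ σ : Finset ι, σ.Nonempty → ∀ b : ℤ, (cechComplex (fun j => p ⁻¹ᵁ cechOpen 𝓤 σ ⊓ q ⁻¹ᵁ 𝓥 j) G ρ).ExactAt b) (n : ℤ) :
    (cechComplex (fun c : ι ×ₗ κ => p ⁻¹ᵁ 𝓤 (ofLex c).1 ⊓ q ⁻¹ᵁ 𝓥 (ofLex c).2) G ρ).ExactAt n := by
  rw [exactAt_cechComplex_prodCover_iff_lexSystem]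
  exact exactAt_sysComplex_lexSystem_of_forall _
    (fun σ hσ b => (exactAt_sysComplex_boxSectionsSystem_obj_iff p q 𝓤 𝓥 G ρ σ b).2 (hcol σ hσ b)) n

/-- **SUPPORT on a product cover**: if the slice Čech complexes `Č((p⁻¹U_σ ∩ q⁻¹V_j)_j, G)` with `#σ ≥ 2` are exact in every degree and the Čech
complex of `G` on the product cover is exact in degree `n`, then for every `i` the slice complex `Č((p⁻¹U_i ∩ q⁻¹V_j)_j, G)` of the single open `U_i` is
exact in degree `n`. [cite: StacksProject, Tag 0133] [cite: MumfordAV1970, §8 proof of Theorem 1 (p. 77)] -/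
theorem exactAt_cechComplex_slice_of_exactAt_prodCover
    (hcol : ∀ σ : Finset ι, 2 ≤ σ.card → ∀ b : ℤ, (cechComplex (fun j => p ⁻¹ᵁ cechOpen 𝓤 σ ⊓ q ⁻¹ᵁ 𝓥 j) G ρ).ExactAt b) (n : ℤ)
    (hn : (cechComplex (fun c : ι ×ₗ κ => p ⁻¹ᵁ 𝓤 (ofLex c).1 ⊓ q ⁻¹ᵁ 𝓥 (ofLex c).2) G ρ).ExactAt n) (i : ι) :
    (cechComplex (fun j => p ⁻¹ᵁ 𝓤 i ⊓ q ⁻¹ᵁ 𝓥 j) G ρ).ExactAt n := by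
  have h := exactAt_sysComplex_obj_singleton_of_exactAt_lexSystem (boxSectionsSystem p q 𝓤 𝓥 G ρ)
    (fun σ hσ b => (exactAt_sysComplex_boxSectionsSystem_obj_iff p q 𝓤 𝓥 G ρ σ b).2 (hcol σ hσ b)) n
    ((exactAt_cechComplex_prodCover_iff_lexSystem p q 𝓤 𝓥 G ρ n).1 hn) i
  rw [exactAt_sysComplex_boxSectionsSystem_obj_iff] at h
  have hcov : (fun j => p ⁻¹ᵁ cechOpen 𝓤 {i} ⊓ q ⁻¹ᵁ 𝓥 j) = fun j => p ⁻¹ᵁ 𝓤 i ⊓ q ⁻¹ᵁ 𝓥 j := by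
    funext j; rw [cechOpen_singleton]
  rw [hcov] at h
  exact h

end Slices

/-! ## §3 Exchanging the two factors -/

section Swap

variable {X Y Z : Scheme.{0}} (p : Z ⟶ X) (q : Z ⟶ Y) {A : Type} [CommRing A]
  {ι κ : Type} [LinearOrder ι] [LinearOrder κ] [Fintype ι] [Fintype κ] (𝓤 : ι → X.Opens) (𝓥 : κ → Y.Opens) (G : Z.Modules)
  (ρ : A →+* Γ(Z, ⊤))

/-- Exactness in degree `n` of a cochain complex of modules is the vanishing of `Hⁿ`. [cite: StacksProject, Tag 0133] -/
theorem exactAt_iff_subsingleton_homology (K : CochainComplex (ModuleCat.{0} A) ℤ) (n : ℤ) :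
    K.ExactAt n ↔ Subsingleton (K.homology n) := by
  rw [exactAt_iff_isZero_homology]
  exact ⟨fun h => ModuleCat.subsingleton_of_isZero h, fun h => ModuleCat.isZero_of_subsingleton _⟩

/-- **The two product covers `(p⁻¹U_i ∩ q⁻¹V_j)_{(i,j) ∈ ι ×ₗ κ}` and `(q⁻¹V_j ∩ p⁻¹U_i)_{(j,i) ∈ κ ×ₗ ι}` have the same exactness in every degree**
(finite families with affine non-empty box intersections covering `Z`, `G` affine-localizing): they consist of the same opens and refine each other along
the swap (★ `subsingleton_homology_iff_of_refines`).  So the collapse of §2 may be run along either factor.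
[cite: StacksProject, Tag 01XD] [cite: StacksProject, Tag 0BEC] [cite: MumfordAV1970, §8 proof of Theorem 1 (p. 77)] -/
theorem exactAt_cechComplex_prodCover_swap_iff
    (hWa : ∀ (s : Finset ι) (t : Finset κ), s.Nonempty → t.Nonempty → IsAffineOpen (p ⁻¹ᵁ cechOpen 𝓤 s ⊓ q ⁻¹ᵁ cechOpen 𝓥 t))
    (hcov : ⨆ c : ι ×ₗ κ, p ⁻¹ᵁ 𝓤 (ofLex c).1 ⊓ q ⁻¹ᵁ 𝓥 (ofLex c).2 = ⊤) (hG : IsAffineLocalizing G) (n : ℤ) :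
    (cechComplex (fun c : ι ×ₗ κ => p ⁻¹ᵁ 𝓤 (ofLex c).1 ⊓ q ⁻¹ᵁ 𝓥 (ofLex c).2) G ρ).ExactAt n ↔
      (cechComplex (fun c : κ ×ₗ ι => q ⁻¹ᵁ 𝓥 (ofLex c).1 ⊓ p ⁻¹ᵁ 𝓤 (ofLex c).2) G ρ).ExactAt n := by
  -- the swapped cover refines the original along the swap, with equal opens
  have hle : ∀ c : κ ×ₗ ι, q ⁻¹ᵁ 𝓥 (ofLex c).1 ⊓ p ⁻¹ᵁ 𝓤 (ofLex c).2 ≤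
      (fun c : ι ×ₗ κ => p ⁻¹ᵁ 𝓤 (ofLex c).1 ⊓ q ⁻¹ᵁ 𝓥 (ofLex c).2) (toLex ((ofLex c).2, (ofLex c).1)) := fun c => by
    simp only [ofLex_toLex]; exact le_of_eq (inf_comm _ _)
  -- affine box intersections for both covers
  have hUa : ∀ s : Finset (ι ×ₗ κ), s.Nonempty →
      IsAffineOpen (cechOpen (fun c : ι ×ₗ κ => p ⁻¹ᵁ 𝓤 (ofLex c).1 ⊓ q ⁻¹ᵁ 𝓥 (ofLex c).2) s) := fun s hs => by
    rw [cechOpen_prodCover_eq]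
    exact hWa _ _ (fstProj_nonempty_iff.2 hs) (sndProj_nonempty_iff.2 hs)
  have hVa : ∀ s : Finset (κ ×ₗ ι), s.Nonempty →
      IsAffineOpen (cechOpen (fun c : κ ×ₗ ι => q ⁻¹ᵁ 𝓥 (ofLex c).1 ⊓ p ⁻¹ᵁ 𝓤 (ofLex c).2) s) := fun s hs => by
    rw [cechOpen_prodCover_eq, inf_comm]
    exact hWa _ _ (sndProj_nonempty_iff.2 hs) (fstProj_nonempty_iff.2 hs)
  have hcov' : ⨆ c : κ ×ₗ ι, q ⁻¹ᵁ 𝓥 (ofLex c).1 ⊓ p ⁻¹ᵁ 𝓤 (ofLex c).2 = ⊤ := by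
    rw [← top_le_iff, ← hcov]
    refine iSup_le fun c => ?_
    have := le_iSup (fun c : κ ×ₗ ι => q ⁻¹ᵁ 𝓥 (ofLex c).1 ⊓ p ⁻¹ᵁ 𝓤 (ofLex c).2) (toLex ((ofLex c).2, (ofLex c).1))
    simp only [ofLex_toLex] at this
    exact (le_of_eq (inf_comm _ _)).trans this
  rw [exactAt_iff_subsingleton_homology, exactAt_iff_subsingleton_homology]
  exact subsingleton_homology_iff_of_refines _ _ G ρ (fun c : κ ×ₗ ι => toLex ((ofLex c).2, (ofLex c).1)) hle hUa hVa hcov hcov' hG n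

end Swap

/-! ## §4 The scalars are irrelevant for exactness (ED. 2) -/

section Scalars

variable {X : Scheme.{u}} {ι : Type} [LinearOrder ι] (𝓥 : ι → X.Opens) (L : X.Modules)
  {A A' : Type u} [CommRing A] [CommRing A'] (ρ : A →+* Γ(X, ⊤)) (ρ' : A' →+* Γ(X, ⊤))

/-- `val (ε • y) = (±1) • val y`: the Čech sign acts through `ρ` as `±1`, whatever the scalars. [folklore]
[cite: GortzWedhorn2023, Def. 21.68 (p. 180)] -/
private theorem val_sign_smul {U : X.Opens} {B : Type u} [CommRing B] (τ : B →+* Γ(X, ⊤)) (s : Finset ι) (a : ι)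
    (y : SecMod L τ U) :
    SecMod.val (L := L) (ρ := τ) (U := U) (sign B s a • y) = ((-1 : Γ(X, U)) ^ (s.filter (· < a)).card) • SecMod.val y := by
  change toSections τ U (sign B s a) • SecMod.val y = _
  unfold sign
  rw [map_pow, map_neg, map_one]

/-- **Change of scalars on cochains**: the identity of `Π_σ Γ(L, V_σ)`, read from `ρ`-cochains to `ρ'`-cochains, preserves values and
intertwines the ordered Čech differentials (restrictions and signs `±1` do not see the scalars). [folklore]
[cite: GortzWedhorn2023, Def. 21.68 (p. 180)] -/
private theorem exists_rescalar :
    ∃ r : ∀ m : ℤ, SysCochain (sectionsSystem 𝓥 L ρ) m → SysCochain (sectionsSystem 𝓥 L ρ') m,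
      (∀ (m : ℤ) (x : SysCochain (sectionsSystem 𝓥 L ρ) m) (σ : Simplex ι m),
          SecMod.val (L := L) (ρ := ρ') (U := cechOpen 𝓥 σ.1) (r m x σ) = SecMod.val (L := L) (ρ := ρ) (U := cechOpen 𝓥 σ.1) (x σ)) ∧
      (∀ (m : ℤ) (x : SysCochain (sectionsSystem 𝓥 L ρ) m),
          r (m + 1) (sysD (sectionsSystem 𝓥 L ρ) m x) = sysD (sectionsSystem 𝓥 L ρ') m (r m x)) := by
  refine ⟨fun m x σ => SecMod.mk (L := L) (ρ := ρ') (SecMod.val (L := L) (ρ := ρ) (U := cechOpen 𝓥 σ.1) (x σ)),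
    fun m x σ => rfl, fun m x => ?_⟩
  -- values of `ext0At` are preserved
  have hext : ∀ (s t : Finset ι),
      SecMod.val (L := L) (ρ := ρ') (U := cechOpen 𝓥 t)
          (SysCochain.ext0At (M := sectionsSystem 𝓥 L ρ')
            (fun σ : Simplex ι m => SecMod.mk (L := L) (ρ := ρ') (SecMod.val (L := L) (ρ := ρ) (U := cechOpen 𝓥 σ.1) (x σ))) s t) =
        SecMod.val (L := L) (ρ := ρ) (U := cechOpen 𝓥 t) (SysCochain.ext0At x s t) := by
    intro s t
    unfold SysCochain.ext0At
    by_cases h : (s.Nonempty ∧ (s.card : ℤ) = m + 1) ∧ s ⊆ t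
    · rw [dif_pos h, dif_pos h, sectionsSystem_map_apply, sectionsSystem_map_apply, SecMod.val_res, SecMod.val_res]
      rfl
    · rw [dif_neg h, dif_neg h]
      rfl
  funext σ
  apply SecMod.val_injective (L := L) (ρ := ρ') (U := cechOpen 𝓥 σ.1)
  change SecMod.val (L := L) (ρ := ρ) (U := cechOpen 𝓥 σ.1) (sysD (sectionsSystem 𝓥 L ρ) m x σ) = _
  rw [sysD_apply, sysD_apply]
  -- `val` is additive: push it through the sums
  let vρ : SecMod L ρ (cechOpen 𝓥 σ.1) →+ Γ(L, cechOpen 𝓥 σ.1) :=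
    { toFun := SecMod.val, map_zero' := rfl, map_add' := fun _ _ => rfl }
  let vρ' : SecMod L ρ' (cechOpen 𝓥 σ.1) →+ Γ(L, cechOpen 𝓥 σ.1) :=
    { toFun := SecMod.val, map_zero' := rfl, map_add' := fun _ _ => rfl }
  change vρ (∑ a ∈ σ.1, sign A σ.1 a • x.ext0At (σ.1.erase a) σ.1) =
    vρ' (∑ a ∈ σ.1, sign A' σ.1 a •
      SysCochain.ext0At (M := sectionsSystem 𝓥 L ρ')
        (fun σ : Simplex ι m => SecMod.mk (L := L) (ρ := ρ') (SecMod.val (L := L) (ρ := ρ) (U := cechOpen 𝓥 σ.1) (x σ)))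
        (σ.1.erase a) σ.1)
  rw [map_sum, map_sum]
  refine Finset.sum_congr rfl fun a _ => ?_
  change SecMod.val (L := L) (ρ := ρ) (U := cechOpen 𝓥 σ.1) (sign A σ.1 a • x.ext0At (σ.1.erase a) σ.1) =
    SecMod.val (L := L) (ρ := ρ') (U := cechOpen 𝓥 σ.1) (sign A' σ.1 a • SysCochain.ext0At (M := sectionsSystem 𝓥 L ρ')
      (fun σ : Simplex ι m => SecMod.mk (L := L) (ρ := ρ') (SecMod.val (L := L) (ρ := ρ) (U := cechOpen 𝓥 σ.1) (x σ)))
      (σ.1.erase a) σ.1)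
  rw [val_sign_smul, val_sign_smul, hext]

/-- **Transfer of exactness along a change of scalars** (the engine of `exactAt_cechComplex_iff_of_scalars`): given value-preserving,
differential-intertwining maps of cochains in both directions, exactness in degree `j` passes from `ρ`- to `ρ'`-scalars. [folklore]
[cite: GortzWedhorn2023, Def. 21.68 (p. 180)] [cite: StacksProject, Tag 0133] -/
private theorem exactAt_of_exactAt_of_rescalar {B B' : Type u} [CommRing B] [CommRing B'] (τ : B →+* Γ(X, ⊤)) (τ' : B' →+* Γ(X, ⊤))
    (r : ∀ m : ℤ, SysCochain (sectionsSystem 𝓥 L τ') m → SysCochain (sectionsSystem 𝓥 L τ) m)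
    (r' : ∀ m : ℤ, SysCochain (sectionsSystem 𝓥 L τ) m → SysCochain (sectionsSystem 𝓥 L τ') m)
    (hr : ∀ (m : ℤ) (x : SysCochain (sectionsSystem 𝓥 L τ') m), r (m + 1) (sysD (sectionsSystem 𝓥 L τ') m x) = sysD (sectionsSystem 𝓥 L τ) m (r m x))
    (hr' : ∀ (m : ℤ) (y : SysCochain (sectionsSystem 𝓥 L τ) m), r' (m + 1) (sysD (sectionsSystem 𝓥 L τ) m y) = sysD (sectionsSystem 𝓥 L τ') m (r' m y))
    (hr0 : ∀ m : ℤ, r m 0 = 0) (hinv : ∀ (m : ℤ) (x : SysCochain (sectionsSystem 𝓥 L τ') m), r' m (r m x) = x)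
    (i j k : ℤ) (hij : i + 1 = j) (hjk : j + 1 = k) (h : (cechComplex 𝓥 L τ).ExactAt j) : (cechComplex 𝓥 L τ').ExactAt j := by
  have hd : ∀ {B : Type u} [CommRing B] (τ : B →+* Γ(X, ⊤)) (m : ℤ) (x : SysCochain (sectionsSystem 𝓥 L τ) m),
      ((cechComplex 𝓥 L τ).d m (m + 1)).hom x = sysD (sectionsSystem 𝓥 L τ) m x := fun τ m x => by
    rw [sysComplex_d]; rfl
  subst hij; subst hjk
  rw [exactAt_iff_function_exact _ i (i + 1) (i + 1 + 1) rfl rfl] at h ⊢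
  intro x'
  constructor
  · intro hx'
    have hx : ((cechComplex 𝓥 L τ).d (i + 1) (i + 1 + 1)).hom (r (i + 1) x') = 0 := by
      rw [hd, ← hr, ← hd τ', hx', hr0]
    obtain ⟨y, hy⟩ := (h _).1 hx
    refine ⟨r' i y, ?_⟩
    rw [hd, ← hr', ← hd τ, hy, hinv]
  · rintro ⟨y, rfl⟩
    rw [← LinearMap.comp_apply, ← ModuleCat.hom_comp, HomologicalComplex.d_comp_d, ModuleCat.hom_zero,
      LinearMap.zero_apply]

/-- **Exactness of the module Čech complex does not depend on the ring of scalars**: for two scalar maps `ρ : A → Γ(X, 𝒪_X)`,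
`ρ' : A' → Γ(X, 𝒪_X)` the complexes `Č(𝓥, L; ρ)` and `Č(𝓥, L; ρ')` have the same underlying additive complex (the cochain groups
`Π_σ Γ(L, V_σ)` and the differentials — restrictions and signs `±1` — do not see the scalars), hence the same exactness in every degree.
(ED. 2: the socket that lets a producer and a consumer of fibre-exactness statements choose their scalars independently — cell
`hodgecm-mathlib`, «CBC cut» (S3).) [cite: GortzWedhorn2023, Def. 21.68 (p. 180)] [cite: StacksProject, Tag 0133] -/
theorem exactAt_cechComplex_iff_of_scalars (n : ℤ) :
    (cechComplex 𝓥 L ρ).ExactAt n ↔ (cechComplex 𝓥 L ρ').ExactAt n := by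
  obtain ⟨r, hrv, hrd⟩ := exists_rescalar 𝓥 L ρ ρ'
  obtain ⟨r', hr'v, hr'd⟩ := exists_rescalar 𝓥 L ρ' ρ
  have hrr' : ∀ (m : ℤ) (x : SysCochain (sectionsSystem 𝓥 L ρ') m), r m (r' m x) = x := fun m x =>
    funext fun σ => SecMod.val_injective (L := L) (ρ := ρ') (U := cechOpen 𝓥 σ.1) (by rw [hrv, hr'v])
  have hr'r : ∀ (m : ℤ) (x : SysCochain (sectionsSystem 𝓥 L ρ) m), r' m (r m x) = x := fun m x =>
    funext fun σ => SecMod.val_injective (L := L) (ρ := ρ) (U := cechOpen 𝓥 σ.1) (by rw [hr'v, hrv])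
  have hr0 : ∀ m : ℤ, r m 0 = 0 := fun m =>
    funext fun σ => SecMod.val_injective (L := L) (ρ := ρ') (U := cechOpen 𝓥 σ.1) (by rw [hrv]; rfl)
  have hr'0 : ∀ m : ℤ, r' m 0 = 0 := fun m =>
    funext fun σ => SecMod.val_injective (L := L) (ρ := ρ) (U := cechOpen 𝓥 σ.1) (by rw [hr'v]; rfl)
  exact ⟨exactAt_of_exactAt_of_rescalar 𝓥 L ρ ρ' r' r hr'd hrd hr'0 hrr' (n - 1) n (n + 1) (by omega) rfl,
    exactAt_of_exactAt_of_rescalar 𝓥 L ρ' ρ r r' hrd hr'd hr0 hr'r (n - 1) n (n + 1) (by omega) rfl⟩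

/-- The `Subsingleton (Ȟⁿ)` form of `exactAt_cechComplex_iff_of_scalars` (universe `0`, the universe of ★ `ModuleCechRefinementTransport`).
[cite: GortzWedhorn2023, Def. 21.68 (p. 180)] -/
theorem subsingleton_homology_cechComplex_iff_of_scalars {X : Scheme.{0}} {ι : Type} [LinearOrder ι] (𝓥 : ι → X.Opens)
    (L : X.Modules) {A A' : Type} [CommRing A] [CommRing A'] (ρ : A →+* Γ(X, ⊤)) (ρ' : A' →+* Γ(X, ⊤)) (n : ℤ) :
    Subsingleton ((cechComplex 𝓥 L ρ).homology n) ↔ Subsingleton ((cechComplex 𝓥 L ρ').homology n) := by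
  rw [← exactAt_iff_subsingleton_homology, ← exactAt_iff_subsingleton_homology, exactAt_cechComplex_iff_of_scalars 𝓥 L ρ ρ']

end Scalars

end Literature.AlgebraicGeometry.Modules

end
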